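import Summits.MatrixMultiplication.MatrixMultiplication.Theorems.EdgePencilSixthLadder
import HarnessLib

/-!
# The sixth-edge ladder, symmetrised (finite level): `R₄(T(K₄)_{e·n⁵}) ≤ R₄(W_n^{(e)})⁶`

Support kernel for `stmt-MatrixMultiplication-26697` (`TetraExcessZero : ω(K₄) ≤ ω(2,1,2)`, the
attacked leaf of route `TetrahedronCarving`; lineage `decomp-mm-lens-6` «barrier-complement
carving», generation 23). No item is added or changed.

THE OBJECT. `W_n^{(e)} = χ[ℓ₀₁ < e] · T(K₄)_n` (`EdgePencil.sixTetra`, kernel `EdgePencilSixth`): the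
tetrahedron graph tensor with edge `01` of bond `e` and the other five edges of bond `n`; its exponent
along `e = ⌈n^δ⌉` is `χ(δ) = omegaSix F δ` (`EdgePencilSixthLadder`: `χ(0) = ω(2,1,2)`, `χ(1) = ω(K₄)`,
`TetraExcessZero ⟺ ∀ δ < 1, χ(δ) ≤ ω(2,1,2)`).

THE MOVE (CVZ19 §2.1, the non-uniform symmetrisation `(nonuniformsymm)` behind Thm. 2.1.6, for the
edge-transitive graph `K₄` and the one-light-edge weighting): the six images of `W` under vertex
symmetries of `K₄` put the light edge once on every edge, so their Kronecker product contains
`T(K₄)` with bond `e·n⁵` on EVERY edge. It is carried out in two strokes, reusing the tree's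
three-fold symmetrisation of the thin-DIAGONAL tetrahedron `Z_N^{(d)}` (`TetraDiagonalSymm`):
* §1 the vertex symmetry `(0 2)(1 3)` carries `W_n^{(e)}` to the tetrahedron thinned on edge `23`
  (`sixTetra_perm₀₂₁₃`), which therefore has a decomposition of length `R₄(W)`
  (`exists_rankOne_decomposition_sixTetra₂₃`);
* §2 the Kronecker product `W ⊠ W^{(02)(13)}` at level `n·n` pulls back, along the identity on five
  edge-label sets and the coordinate swap on edge `23`, to the thin-diagonal tetrahedron
  `Z_{n²}^{(e·n)}` (`sixPair_pullback_apply`; the point is `⌊y/n⌋ < e ⟺ y < e·n`), whence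
  `R₄(Z_{n²}^{(e·n)}) ≤ R₄(W_n^{(e)})²` (`tensorRankD_diagTetra_sq_le`) with NO size hypothesis;
* §3 with the tree's `R₄(T(K₄)_{d·N²}) ≤ R₄(Z_N^{(d)})³` (`d ≤ N`; here `N = n²`, `d = e·n`):
  `R₄(T(K₄)_{e·n·(n²·n²)}) ≤ R₄(W_n^{(e)})⁶` for `e ≤ n` (`tensorRankD_tetra_le_sixTetra_pow_six`), and
  the one-level certificate form `R₄(W_n^{(e)})⁶ ≤ (e·n⁵)^θ ⟹ ω(K₄) ≤ θ` (`omegaTetra_le_of_sixLevel`).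
* The exponent consequences `(5+δ)·ω(K₄) ≤ 6·χ(δ)` and the re-priced rungs are in the companion
  module `EdgePencilSixthSymmetrisationExponent`.

References: Christandl–Vrana–Zuiddam, arXiv:1609.07476, Ex. 1.1.2, §1.1 (graph tensors multiply under
`⊠`, restriction), §2.1 `(nonuniformsymm)` and Thm. 2.1.6 [ChristandlVranaZuiddam2016];
[corpus:paper-arxiv-1609.07476 p.11–12]. No `sorry`, no new axiom, no instance, no notation, no definition.
-/

noncomputable section

set_option linter.dupNamespace false

open Filter Asymptotics Literature.Computability.AlgebraicComplexity
open Summit.MatrixMultiplication.MatrixMultiplication.Theorems.TetrahedronTensor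
open Summit.MatrixMultiplication.MatrixMultiplication.Theorems.TetraDiagonal
open Summit.MatrixMultiplication.MatrixMultiplication.Theses.TetrahedronCarving

namespace Summit.MatrixMultiplication.MatrixMultiplication.Theorems.EdgePencil

/-! ## §1 The vertex symmetry `(0 2)(1 3)`: `W` and the `23`-thinned tetrahedron have the same rank -/

section Symmetry

variable {F : Type*} [Field F]

/-- **Vertex symmetry `(0 2)(1 3)`** of `K₄` (legs permuted, with the induced slot permutations: the new
leg `0` reads the old leg `2` in slot order `(23, 02, 12) ↦ (01, 02, 03)`, etc.) carries `W_n^{(e)}`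
(edge `01` thinned) to the tetrahedron with edge `23` thinned. [folklore] -/
theorem sixTetra_perm₀₂₁₃ (n e : ℕ) (i : Fin 4 → Fin (n ^ 3)) :
    sixTetra F n e
        ![finFunctionFinEquiv ![finFunctionFinEquiv.symm (i 2) 2, finFunctionFinEquiv.symm (i 2) 0,
            finFunctionFinEquiv.symm (i 2) 1],
          finFunctionFinEquiv ![finFunctionFinEquiv.symm (i 3) 2, finFunctionFinEquiv.symm (i 3) 0,
            finFunctionFinEquiv.symm (i 3) 1],
          finFunctionFinEquiv ![finFunctionFinEquiv.symm (i 0) 1, finFunctionFinEquiv.symm (i 0) 2,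
            finFunctionFinEquiv.symm (i 0) 0],
          finFunctionFinEquiv ![finFunctionFinEquiv.symm (i 1) 1, finFunctionFinEquiv.symm (i 1) 2,
            finFunctionFinEquiv.symm (i 1) 0]] =
      thinInd F n e 2 (i 2) * tetra F n i := by
  have ht : tetra F n
      ![finFunctionFinEquiv ![finFunctionFinEquiv.symm (i 2) 2, finFunctionFinEquiv.symm (i 2) 0,
            finFunctionFinEquiv.symm (i 2) 1],
          finFunctionFinEquiv ![finFunctionFinEquiv.symm (i 3) 2, finFunctionFinEquiv.symm (i 3) 0,
            finFunctionFinEquiv.symm (i 3) 1],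
          finFunctionFinEquiv ![finFunctionFinEquiv.symm (i 0) 1, finFunctionFinEquiv.symm (i 0) 2,
            finFunctionFinEquiv.symm (i 0) 0],
          finFunctionFinEquiv ![finFunctionFinEquiv.symm (i 1) 1, finFunctionFinEquiv.symm (i 1) 2,
            finFunctionFinEquiv.symm (i 1) 0]] = tetra F n i := by
    simp only [tetra]
    refine if_congr ?_ rfl rfl
    simp only [consistent_iff, Matrix.cons_val_zero, Matrix.cons_val_one, Matrix.cons_val_two,
      Matrix.cons_val_three, Matrix.head_cons, Matrix.tail_cons, Equiv.symm_apply_apply]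
    constructor
    · rintro ⟨h1, h2, h3, h4, h5, h6⟩
      exact ⟨h6, h2.symm, h4.symm, h3.symm, h5.symm, h1⟩
    · rintro ⟨h1, h2, h3, h4, h5, h6⟩
      exact ⟨h6, h2.symm, h4.symm, h3.symm, h5.symm, h1⟩
  unfold sixTetra
  rw [ht]
  simp only [thinInd, Matrix.cons_val_zero, Equiv.symm_apply_apply]

/-- A rank-one decomposition of length `R₄(W_n^{(e)})` of the `23`-thinned tetrahedron
`χ[ℓ₂₃ < e] · T(K₄)_n` (transport along `sixTetra_perm₀₂₁₃`). [folklore] -/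
theorem exists_rankOne_decomposition_sixTetra₂₃ (n e : ℕ) :
    ∃ u : Fin (tensorRankD (sixTetra F n e)) → Fin 4 → Fin (n ^ 3) → F,
      ∑ k, rankOneTensor (u k) = fun i => thinInd F n e 2 (i 2) * tetra F n i := by
  classical
  obtain ⟨u, hu⟩ := exists_rankOne_decomposition_sixTetra (F := F) n e
  refine ⟨fun k => ![fun x => u k 2 (finFunctionFinEquiv ![finFunctionFinEquiv.symm x 1,
      finFunctionFinEquiv.symm x 2, finFunctionFinEquiv.symm x 0]),
      fun x => u k 3 (finFunctionFinEquiv ![finFunctionFinEquiv.symm x 1,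
        finFunctionFinEquiv.symm x 2, finFunctionFinEquiv.symm x 0]),
      fun x => u k 0 (finFunctionFinEquiv ![finFunctionFinEquiv.symm x 2,
        finFunctionFinEquiv.symm x 0, finFunctionFinEquiv.symm x 1]),
      fun x => u k 1 (finFunctionFinEquiv ![finFunctionFinEquiv.symm x 2,
        finFunctionFinEquiv.symm x 0, finFunctionFinEquiv.symm x 1])], ?_⟩
  funext i
  have hi := congrFun hu
    ![finFunctionFinEquiv ![finFunctionFinEquiv.symm (i 2) 2, finFunctionFinEquiv.symm (i 2) 0,
        finFunctionFinEquiv.symm (i 2) 1],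
      finFunctionFinEquiv ![finFunctionFinEquiv.symm (i 3) 2, finFunctionFinEquiv.symm (i 3) 0,
        finFunctionFinEquiv.symm (i 3) 1],
      finFunctionFinEquiv ![finFunctionFinEquiv.symm (i 0) 1, finFunctionFinEquiv.symm (i 0) 2,
        finFunctionFinEquiv.symm (i 0) 0],
      finFunctionFinEquiv ![finFunctionFinEquiv.symm (i 1) 1, finFunctionFinEquiv.symm (i 1) 2,
        finFunctionFinEquiv.symm (i 1) 0]]
  rw [sixTetra_perm₀₂₁₃, Finset.sum_apply] at hi
  rw [← hi, Finset.sum_apply]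
  refine Finset.sum_congr rfl fun k _ => ?_
  simp only [rankOneTensor_apply, Fin.prod_univ_four, Matrix.cons_val_zero, Matrix.cons_val_one,
    Matrix.cons_val_two, Matrix.cons_val_three, Matrix.head_cons, Matrix.tail_cons]
  ring

end Symmetry

/-! ## §2 `W ⊠ W^{(02)(13)}` contains the thin-diagonal tetrahedron `Z_{n²}^{(e·n)}` -/

section Pair

variable {F : Type*} [Field F]

/-- **The pair product** `W_n^{(e)} ⊠ (χ[ℓ₂₃ < e]·T(K₄)_n)` at level `n·n` (pair labels; first
components through `W`, second components through the `23`-thinned copy) has a rank-one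
decomposition of length `R₄(W_n^{(e)})²`. [cite: ChristandlVranaZuiddam2016, Prop. 1.1.16 (proof)] -/
theorem exists_rankOne_decomposition_sixPair (n e : ℕ) :
    ∃ u : Fin (tensorRankD (sixTetra F n e) * tensorRankD (sixTetra F n e)) →
        Fin 4 → Fin ((n * n) ^ 3) → F,
      ∑ k, rankOneTensor (u k) = fun i =>
        sixTetra F n e (fun v => K₁ (i v)) *
          (thinInd F n e 2 (K₂ (i 2)) * tetra F n (fun v => K₂ (i v))) := by
  obtain ⟨u₁, hu₁⟩ := exists_rankOne_decomposition_sixTetra (F := F) n e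
  obtain ⟨u₂, hu₂⟩ := exists_rankOne_decomposition_sixTetra₂₃ (F := F) n e
  exact exists_rankOne_decomposition_mulK hu₁ hu₂

/-- **The embedding, pointwise.** Along per-edge relabellings `ι_k` of the six label sets `Fin (n·n)`
(applied at both endpoints) such that the light test of `W` on edge `01` and the light test of the
thinned copy on edge `23` both read `y < e·n` (`h01`, `h23`: first, resp. second, pair component `< e`),
the pair product pulls back to `Z_{n·n}^{(e·n)}`: the two tetrahedron factors recombine
(`tetra_mul_apply`, `tetra_relabel`). [cite: ChristandlVranaZuiddam2016, §2.1 (nonuniformsymm)] -/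
theorem sixPair_pullback_apply {n e : ℕ} (ι : Fin 6 → Fin (n * n) → Fin (n * n))
    (hι : ∀ k, Function.Injective (ι k))
    (h01 : ∀ y, (((finProdFinEquiv.symm (ι 0 y)).1 : Fin n) : ℕ) < e ↔ (y : ℕ) < e * n)
    (h23 : ∀ y, (((finProdFinEquiv.symm (ι 5 y)).2 : Fin n) : ℕ) < e ↔ (y : ℕ) < e * n)
    (x : Fin 4 → Fin ((n * n) ^ 3)) :
    (fun y : Fin 4 → Fin ((n * n) ^ 3) =>
        sixTetra F n e (fun v => K₁ (y v)) *
          (thinInd F n e 2 (K₂ (y 2)) * tetra F n (fun v => K₂ (y v))))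
        (fun v => finFunctionFinEquiv fun j =>
          ι (vertexLabels (fun k : Fin 6 => k) v j) (finFunctionFinEquiv.symm (x v) j)) =
      diagTetra F (n * n) (e * n) x := by
  have e01 : thinInd F n e 0 (K₁ (finFunctionFinEquiv fun j =>
      ι (vertexLabels (fun k : Fin 6 => k) 0 j) (finFunctionFinEquiv.symm (x 0) j))) =
      thinInd F (n * n) (e * n) 0 (x 0) := by
    unfold thinInd
    refine if_congr ?_ rfl rfl
    rw [symm_K₁_apply, Equiv.symm_apply_apply]
    exact h01 _
  have e23 : thinInd F n e 2 (K₂ (finFunctionFinEquiv fun j =>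
      ι (vertexLabels (fun k : Fin 6 => k) 2 j) (finFunctionFinEquiv.symm (x 2) j))) =
      thinInd F (n * n) (e * n) 2 (x 2) := by
    unfold thinInd
    refine if_congr ?_ rfl rfl
    rw [symm_K₂_apply, Equiv.symm_apply_apply]
    exact h23 _
  have hrel := tetra_relabel (F := F) ι hι x
  have hm := tetra_mul_apply (F := F) (N := n) (M := n) (fun v => finFunctionFinEquiv fun j =>
      ι (vertexLabels (fun k : Fin 6 => k) v j) (finFunctionFinEquiv.symm (x v) j))
  simp only []
  rw [sixTetra, diagTetra, prod_thinLegs, e01, e23, ← hrel, hm]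
  ring

/-- **`R₄(Z_{n·n}^{(e·n)}) ≤ R₄(W_n^{(e)})²`** (no size hypothesis): pull the pair product back along the
identity on the labels of edges `01, 02, 03, 12, 13` and the pair-coordinate swap on edge `23`
(`⌊y/n⌋ < e ⟺ y < e·n`). [cite: ChristandlVranaZuiddam2016, §2.1 (nonuniformsymm)] -/
theorem tensorRankD_diagTetra_sq_le (n e : ℕ) :
    tensorRankD (diagTetra F (n * n) (e * n)) ≤
      tensorRankD (sixTetra F n e) * tensorRankD (sixTetra F n e) := by
  classical
  obtain ⟨u, hu⟩ := exists_rankOne_decomposition_sixPair (F := F) n e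
  -- the per-edge relabellings: identity ×5, coordinate swap on edge `23`
  let ι : Fin 6 → Fin (n * n) → Fin (n * n) :=
    ![fun y => y, fun y => y, fun y => y, fun y => y, fun y => y,
      fun y => finProdFinEquiv ((finProdFinEquiv.symm y).2, (finProdFinEquiv.symm y).1)]
  have hid : Function.Injective (fun y : Fin (n * n) => y) := fun _ _ h => h
  have hswap : Function.Injective (fun y : Fin (n * n) =>
      finProdFinEquiv ((finProdFinEquiv.symm y).2, (finProdFinEquiv.symm y).1)) := by
    intro y y' h
    simp only [Equiv.apply_eq_iff_eq, Prod.mk.injEq] at h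
    exact finProdFinEquiv.symm.injective (Prod.ext h.2 h.1)
  have hι : ∀ k, Function.Injective (ι k) := fun k => by fin_cases k <;> assumption
  have hdiv : ∀ y : Fin (n * n),
      (((finProdFinEquiv.symm y).1 : Fin n) : ℕ) < e ↔ (y : ℕ) < e * n := by
    intro y
    have hn : 0 < n := by
      rcases Nat.eq_zero_or_pos n with h | h
      · exact absurd y.isLt (by simp [h])
      · exact h
    rw [finProdFinEquiv_symm_apply, Fin.coe_divNat]
    exact Nat.div_lt_iff_lt_mul hn
  have key := funext (sixPair_pullback_apply (F := F) (e := e) ι hι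
    (fun y => by simp only [ι, Matrix.cons_val_zero]; exact hdiv y)
    (fun y => by simp only [ι, Matrix.cons_val, Equiv.symm_apply_apply]; exact hdiv y))
  rw [← key]
  refine (tensorRankD_pullback_le _
    (fun v x => finFunctionFinEquiv fun j =>
      ι (vertexLabels (fun k : Fin 6 => k) v j) (finFunctionFinEquiv.symm x j))
    ⟨_, fun k => rankOneTensor (u k), fun k => rankOneTensor_mem _, hu⟩).trans ?_
  exact tensorRankD_le_of_eq_sum u hu

end Pair

/-! ## §3 Symmetrisation at a finite level: `R₄(T(K₄)_{e·n⁵}) ≤ R₄(W_n^{(e)})⁶` -/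

section Finite

variable {F : Type*} [Field F]

/-- **Six-fold symmetrisation at a finite level** (CVZ19 `(nonuniformsymm)` for `K₄`, one light edge):
`R₄(T(K₄)_{(e·n)·(n²·n²)}) ≤ R₄(W_n^{(e)})⁶` for `e ≤ n` — the pair step (§2) followed by the tree's
three-fold symmetrisation of `Z_{n²}^{(e·n)}` (`tensorRankD_tetra_le_diagTetra_cube`).
[cite: ChristandlVranaZuiddam2016, §2.1 (nonuniformsymm)] -/
theorem tensorRankD_tetra_le_sixTetra_pow_six {n e : ℕ} (he : e ≤ n) :
    tensorRankD (tetra F ((e * n) * ((n * n) * (n * n)))) ≤ tensorRankD (sixTetra F n e) ^ 6 := by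
  have h1 := tensorRankD_tetra_le_diagTetra_cube (F := F) (n := n * n) (d := e * n)
    (Nat.mul_le_mul_right n he)
  have h2 := tensorRankD_diagTetra_sq_le (F := F) n e
  calc tensorRankD (tetra F ((e * n) * ((n * n) * (n * n))))
      ≤ tensorRankD (diagTetra F (n * n) (e * n)) ^ 3 := h1
    _ ≤ (tensorRankD (sixTetra F n e) * tensorRankD (sixTetra F n e)) ^ 3 :=
        Nat.pow_le_pow_left h2 3
    _ = tensorRankD (sixTetra F n e) ^ 6 := by ring

/-- The same with the level written as `e · n⁵`. [cite: ChristandlVranaZuiddam2016, §2.1 (nonuniformsymm)] -/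
theorem tensorRankD_tetra_le_sixTetra_pow_six' {n e : ℕ} (he : e ≤ n) :
    tensorRankD (tetra F (e * n ^ 5)) ≤ tensorRankD (sixTetra F n e) ^ 6 := by
  have h := tensorRankD_tetra_le_sixTetra_pow_six (F := F) he
  have hl : e * n ^ 5 = (e * n) * ((n * n) * (n * n)) := by ring
  rw [hl]
  exact h

end Finite

section Level

variable (F : Type) [Field F]

/-- **One rank certificate on `W` bounds `ω(K₄)`**: `R₄(W_n^{(e)})⁶ ≤ L^θ` at the level
`L = (e·n)·(n²·n²) ≥ 2` (`e ≤ n`, `θ ≥ 0`) gives `ω(K₄) ≤ θ` (the tree's level certificate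
`omegaTetra_le_of_level` behind the symmetrisation). [cite: ChristandlVranaZuiddam2016, Prop. 1.1.16] -/
theorem omegaTetra_le_of_sixLevel {n e : ℕ} {θ : ℝ} (he : e ≤ n)
    (hL : 2 ≤ (e * n) * ((n * n) * (n * n))) (hθ : 0 ≤ θ)
    (hcert : ((tensorRankD (sixTetra F n e) : ℕ) : ℝ) ^ 6 ≤
      (((e * n) * ((n * n) * (n * n)) : ℕ) : ℝ) ^ θ) :
    omegaTetra F ≤ θ := by
  refine omegaTetra_le_of_level F hL hθ ?_
  have h := tensorRankD_tetra_le_sixTetra_pow_six (F := F) he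
  calc (tensorRankD (tetra F ((e * n) * ((n * n) * (n * n)))) : ℝ)
      ≤ ((tensorRankD (sixTetra F n e) ^ 6 : ℕ) : ℝ) := by exact_mod_cast h
    _ = ((tensorRankD (sixTetra F n e) : ℕ) : ℝ) ^ 6 := by push_cast; ring
    _ ≤ _ := hcert

end Level

end Summit.MatrixMultiplication.MatrixMultiplication.Theorems.EdgePencil

end
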